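import Literature.AlgebraicGeometry.Pohlmann1968.HodgeClassesProductSpanCMProductsRealIntersection
import Summits.HodgeConjecture.CorCM.DisjointCMProductsHodge
import HarnessLib

/-!
# COR-CM — the Hodge conjecture is multiplicative across CM products whose Galois closures MEET IN A TOTALLY REAL FIELD

COUNT-NEUTRAL own-lane brick of seat b25 (cell `pub-hodgecm2`): no binder row of `HOME/BINDER-OWNERS.md` is touched,
`Interfaces.lean` / the E term / the PerL interface are untouched.  HONEST FRAMING: unconditional consequences of
structure theorems on Hodge classes of CM abelian varieties
(`Literature/AlgebraicGeometry/Pohlmann1968/HodgeClassesProductSpanCMProductsRealIntersection`); not a step of the summit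
chain.  Sequel of `CorCM/DisjointCMProductsHodge` (composita of Galois closures meeting in `ℚ`), with `ℚ` replaced by ANY
TOTALLY REAL FIELD: for CM products `X ∼ ⨁ A_i`, `Y ∼ ⨁ A'_j` (realisations of ARBITRARY CM types of CM fields `K_i`,
`K'_j`) such that complex conjugation fixes `(∏ K_i^{gal}) ∩ (∏ K'_j^{gal})` pointwise — e.g. an intersection of odd
degree — `HC(X) ∧ HC(Y) ⟹ HC(B)` for every `B` dominated by `X × Y`.  Mechanism: a partial conjugation in `Aut(ℂ)`
(b23's gluing lemma `exists_ringEquiv_apply_eq_of_normal`), hence `Hg(X × Y) = Hg(X) × Hg(Y)`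
(`typeRank_sum_add_one_eq_of_partialConj`), hence the product-span property (`hodgeClassesProductSpan_biproduct_of_typeRank_add`).
Compared with `CorCM/RealIntersectionCMFieldsHodge` (b23: the same fields, NONDEGENERATE types, `B• = D•`), no type
needs to be nondegenerate — `HC(X)` may be Markman's theorem on a degenerate Weil-type pair.

* §1 `hodgeConjectureFor_of_avDominatedBy_prod_of_conj_apply_eq`, `…_of_odd_finrank_inf` (dependent families);
* §2 two CM fields `F₁`, `F₂` with `F₁^{gal} ∩ F₂^{gal}` totally real: `…_cmProdAV_prod_cmProdAV_of_conj_apply_eq`,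
  `…_isProductOf_prod_isProductOf_of_conj_apply_eq` (product trees of realisations of types of CM fields embeddable in
  `F₁`, resp. `F₂`), `…_of_odd_finrank`;
* §3 (namespace `CyclicSextic`) **two Galois SEXTIC CM fields `K₁`, `K₂` whose intersection is totally real** (e.g.
  `ℚ(ζ₇) = ℚ(√−7)·ℚ(ζ₇)⁺` and `ℚ(ζ₇)⁺(√−3)`, or `ℚ(ζ₉)` and `ℚ(ζ₉)⁺(√−d)`: intersection the real cubic field): HC for
  every abelian variety dominated by `P₁ × P₂`, `P_r` a product tree of realisations of CM types of CM fields embeddable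
  in `K_r`, GIVEN ONLY Markman's fourfold theorem (b30's rung `hodgeConjectureFor_cmProdAV_sextic_of_markman_closed` on
  BOTH sides) — `hodgeConjectureFor_of_avDominatedBy_isProductOf_prod_isProductOf_two_sextics_of_markman`, `…_of_odd_finrank`;
  the disjoint file's E′-clause needed `K ∩ k′^{gal} = ℚ`.

THEOREMS ONLY; no definition, no named fact, no `sorry`; axioms `propext`, `Classical.choice`, `Quot.sound`.

## References
* [MoonenZarhin1999LowDim] B. Moonen, Yu. Zarhin, Math. Ann. 315 (1999), §3 (3.1).
* [Gordon1999HodgeAVSurvey] B. B. Gordon, *A survey of the Hodge conjecture for abelian varieties*, §3 Theorem (Imai,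
  Murty) with proof.
* [Markman2025SurveySecant] E. Markman, arXiv:2509.23403, Thm. 1.2.
* [Shimura1998] G. Shimura, *Abelian Varieties with Complex Multiplication and Modular Functions*, §6.1–6.2.
* [Lang2002] S. Lang, *Algebra*, VI §1 Thm. 1.14, V §2 Thm. 2.8.
-/

noncomputable section

open CategoryTheory CategoryTheory.Limits NumberField IntermediateField

namespace Summit.HodgeConjecture.CorCM

open Literature.AlgebraicGeometry.Motives (AbelianVariety CMType)
open Literature.AlgebraicGeometry.Motives.AbelianVariety
open Literature.AlgebraicGeometry.HodgeTheory
open Literature.AlgebraicGeometry.ComplexMultiplication (IsCMTypeRealisation Shimura1998_Thm2_Cor_holds)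
open Literature.AlgebraicGeometry.Pohlmann1968
open Literature.NumberTheory.ComplexMultiplication (normal_normalClosure_complex conj_apply_eq_of_odd_finrank)
open Literature.NumberTheory.Automorphic.PicardCM (cmRealisation CMAbelianVarietyRealised)
open Summit.HodgeConjecture.CorCM.Domination

/-! ## §1 Dependent families -/

section Families

variable {n m : ℕ} {K : Fin n → Type} {K' : Fin m → Type}
  [∀ i, Field (K i)] [∀ i, NumberField (K i)] [∀ j, Field (K' j)] [∀ j, NumberField (K' j)]
  [∀ i, IsCMField (K i)] [∀ j, IsCMField (K' j)]
  {Φ : ∀ i, CMType (K i)} {Φ' : ∀ j, CMType (K' j)}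
  {A : Fin n → AbelianVariety ℂ} {A' : Fin m → AbelianVariety ℂ}
  {ι : ∀ i, 𝓞 (K i) →+* End (A i)} {ι' : ∀ j, 𝓞 (K' j) →+* End (A' j)}
  {θ : ∀ i, K i →+* Module.End ℂ (complexBetti (A i).X 1)}
  {θ' : ∀ j, K' j →+* Module.End ℂ (complexBetti (A' j).X 1)}

/-- **HC is multiplicative across CM products whose Galois closures meet in a totally real field (domination form).**
For realisations `(A_i, ι_i, θ_i)` of ARBITRARY CM types of CM fields `K_i` (`i < n`, `n ≠ 0`) and `(A'_j, …)` of
`K'_j` (`j < m`, `m ≠ 0`) with complex conjugation fixing `(∏_i K_i^{gal}) ∩ (∏_j K'_j^{gal})` pointwise,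
`X ∼ ⨁ A_i`, `Y ∼ ⨁ A'_j`: `HC(X) ∧ HC(Y) ⟹ HC(B)` for every `B` dominated by `X × Y`.
[cite: MoonenZarhin1999LowDim, §3 (3.1)] [cite: Gordon1999HodgeAVSurvey, §3 Theorem (Imai, Murty) with proof] -/
theorem hodgeConjectureFor_of_avDominatedBy_prod_of_conj_apply_eq [NeZero n] [NeZero m]
    (hA : ∀ i, IsCMTypeRealisation (Φ i) (A i) (ι i) (θ i))
    (hA' : ∀ j, IsCMTypeRealisation (Φ' j) (A' j) (ι' j) (θ' j))
    (H : ∀ x : ℂ, x ∈ (⨆ i, normalClosure ℚ (K i) ℂ) → x ∈ (⨆ j, normalClosure ℚ (K' j) ℂ) →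
      starRingEnd ℂ x = x)
    {X Y B : AbelianVariety ℂ} (hX : IsIsogenous X (⨁ A)) (hY : IsIsogenous Y (⨁ A'))
    (hHX : HodgeConjectureFor X.dim X.X) (hHY : HodgeConjectureFor Y.dim Y.X)
    (hB : AVDominatedBy B (X.prod Y)) : HodgeConjectureFor B.dim B.X :=
  hodgeConjectureFor_of_avDominatedBy
    (hodgeConjectureFor_prod_of_isIsogenous_biproduct_of_conj_apply_eq hA hA' H hX hY hHX hHY) hB

/-- **Odd-degree form**: `[(∏_i K_i^{gal}) ∩ (∏_j K'_j^{gal}) : ℚ]` odd ⟹ `HC(X) ∧ HC(Y) ⟹ HC(B)` for every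
`B ≼ X × Y`. [cite: MoonenZarhin1999LowDim, §3 (3.1)] [cite: Gordon1999HodgeAVSurvey, §3 Theorem (Imai, Murty) with proof] -/
theorem hodgeConjectureFor_of_avDominatedBy_prod_of_odd_finrank_inf [NeZero n] [NeZero m]
    (hA : ∀ i, IsCMTypeRealisation (Φ i) (A i) (ι i) (θ i))
    (hA' : ∀ j, IsCMTypeRealisation (Φ' j) (A' j) (ι' j) (θ' j))
    (hodd : Odd (Module.finrank ℚ ↥((⨆ i, normalClosure ℚ (K i) ℂ) ⊓ (⨆ j, normalClosure ℚ (K' j) ℂ))))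
    {X Y B : AbelianVariety ℂ} (hX : IsIsogenous X (⨁ A)) (hY : IsIsogenous Y (⨁ A'))
    (hHX : HodgeConjectureFor X.dim X.X) (hHY : HodgeConjectureFor Y.dim Y.X)
    (hB : AVDominatedBy B (X.prod Y)) : HodgeConjectureFor B.dim B.X :=
  hodgeConjectureFor_of_avDominatedBy
    (hodgeConjectureFor_prod_of_isIsogenous_biproduct_of_odd_finrank_inf hA hA' hodd hX hY hHX hHY) hB

end Families

/-! ## §2 Two CM fields whose Galois closures meet in a totally real field -/

section TwoFields

variable {F₁ F₂ : Type} [Field F₁] [NumberField F₁] [IsCMField F₁] [Field F₂] [NumberField F₂] [IsCMField F₂]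

omit [IsCMField F₁] [IsCMField F₂] in
/-- `[F₁^{gal} ∩ F₂^{gal} : ℚ]` odd ⟹ complex conjugation fixes `F₁^{gal} ∩ F₂^{gal}` pointwise (a Galois subfield of
`ℂ` of odd degree is totally real). [cite: Lang2002, VI §1 Thm. 1.14] -/
theorem conj_apply_eq_of_odd_finrank_normalClosure_inf
    (hodd : Odd (Module.finrank ℚ ↥(normalClosure ℚ F₁ ℂ ⊓ normalClosure ℚ F₂ ℂ))) :
    ∀ x : ℂ, x ∈ normalClosure ℚ F₁ ℂ → x ∈ normalClosure ℚ F₂ ℂ → starRingEnd ℂ x = x := by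
  intro x h₁ h₂
  haveI : @Normal ℚ ↥(normalClosure ℚ F₁ ℂ) _ _ (IntermediateField.algebra' _) :=
    normal_normalClosure_complex (K := fun _ : Unit => F₁) ()
  haveI : @Normal ℚ ↥(normalClosure ℚ F₂ ℂ) _ _ (IntermediateField.algebra' _) :=
    normal_normalClosure_complex (K := fun _ : Unit => F₂) ()
  letI : Algebra ℚ ↥(normalClosure ℚ F₁ ℂ ⊓ normalClosure ℚ F₂ ℂ) := IntermediateField.algebra' _
  have hle : normalClosure ℚ F₁ ℂ ⊓ normalClosure ℚ F₂ ℂ ≤ normalClosure ℚ F₁ ℂ := inf_le_left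
  haveI : FiniteDimensional ℚ ↥(normalClosure ℚ F₁ ℂ ⊓ normalClosure ℚ F₂ ℂ) :=
    FiniteDimensional.of_injective (IntermediateField.inclusion hle).toLinearMap
      (IntermediateField.inclusion_injective hle)
  exact conj_apply_eq_of_odd_finrank _ hodd ⟨h₁, h₂⟩

/-- **`HC(∏_j A_{(F₁,Θ¹_j)}) ∧ HC(∏_j A_{(F₂,Θ²_j)}) ⟹ HC(B)` for every `B ≼ ∏_j A_{(F₁,Θ¹_j)} × ∏_j A_{(F₂,Θ²_j)}`**,
for CM fields `F₁`, `F₂` with `F₁^{gal} ∩ F₂^{gal}` TOTALLY REAL (complex conjugation fixes it pointwise) and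
ARBITRARY CM types. [cite: MoonenZarhin1999LowDim, §3 (3.1)] [cite: Gordon1999HodgeAVSurvey, §3 Theorem (Imai, Murty) with proof] -/
theorem hodgeConjectureFor_of_avDominatedBy_cmProdAV_prod_cmProdAV_of_conj_apply_eq (h₃ : CMAbelianVarietyRealised)
    (H : ∀ x : ℂ, x ∈ normalClosure ℚ F₁ ℂ → x ∈ normalClosure ℚ F₂ ℂ → starRingEnd ℂ x = x)
    {n₁ n₂ : ℕ} {Θ₁ : Fin (n₁ + 1) → CMType F₁} {Θ₂ : Fin (n₂ + 1) → CMType F₂}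
    (h₁ : HodgeConjectureFor (cmProdAV F₁ h₃ n₁ Θ₁).dim (cmProdAV F₁ h₃ n₁ Θ₁).X)
    (h₂ : HodgeConjectureFor (cmProdAV F₂ h₃ n₂ Θ₂).dim (cmProdAV F₂ h₃ n₂ Θ₂).X)
    {B : AbelianVariety ℂ} (hB : AVDominatedBy B ((cmProdAV F₁ h₃ n₁ Θ₁).prod (cmProdAV F₂ h₃ n₂ Θ₂))) :
    HodgeConjectureFor B.dim B.X := by
  obtain ⟨e₁⟩ := nonempty_cmProdAV_iso_biproduct F₁ h₃ n₁ Θ₁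
  obtain ⟨e₂⟩ := nonempty_cmProdAV_iso_biproduct F₂ h₃ n₂ Θ₂
  have H' : ∀ x : ℂ, x ∈ (⨆ _ : Fin (n₁ + 1), normalClosure ℚ F₁ ℂ) →
      x ∈ (⨆ _ : Fin (n₂ + 1), normalClosure ℚ F₂ ℂ) → starRingEnd ℂ x = x := by
    rw [iSup_const, iSup_const]
    exact H
  exact hodgeConjectureFor_of_avDominatedBy_prod_of_conj_apply_eq
    (K := fun _ : Fin (n₁ + 1) => F₁) (K' := fun _ : Fin (n₂ + 1) => F₂)
    (fun j => isCMTypeRealisation_cmCode F₁ h₃ (Θ₁ j)) (fun j => isCMTypeRealisation_cmCode F₂ h₃ (Θ₂ j)) H'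
    ⟨e₁.hom, isIsogeny_hom_of_iso e₁⟩ ⟨e₂.hom, isIsogeny_hom_of_iso e₂⟩ h₁ h₂ hB

/-- **Product trees over two fields with totally real intersection of Galois closures.**  `P₁`, `P₂` finite products of
realisations of CM types of CM fields embeddable in `F₁`, resp. `F₂`; if HC holds for every `∏_j A_{(F₁,Θ_j)}` and
every `∏_j A_{(F₂,Θ_j)}`, then HC holds for every `B ≼ P₁ × P₂` (Shimura inflation on each side).
[cite: Shimura1998, §6.2 Theorem 3 and §6.1 Corollary of Theorem 2 (pp. 41–43)] [cite: MoonenZarhin1999LowDim, §3 (3.1)] -/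
theorem hodgeConjectureFor_of_avDominatedBy_isProductOf_prod_isProductOf_of_conj_apply_eq
    (h₃ : CMAbelianVarietyRealised)
    (H : ∀ x : ℂ, x ∈ normalClosure ℚ F₁ ℂ → x ∈ normalClosure ℚ F₂ ℂ → starRingEnd ℂ x = x)
    (hHC₁ : ∀ (n : ℕ) (Θ : Fin (n + 1) → CMType F₁),
      HodgeConjectureFor (cmProdAV F₁ h₃ n Θ).dim (cmProdAV F₁ h₃ n Θ).X)
    (hHC₂ : ∀ (n : ℕ) (Θ : Fin (n + 1) → CMType F₂),
      HodgeConjectureFor (cmProdAV F₂ h₃ n Θ).dim (cmProdAV F₂ h₃ n Θ).X)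
    {P₁ P₂ B : AbelianVariety ℂ}
    (hP₁ : AbelianVariety.IsProductOf (fun B : AbelianVariety ℂ =>
      ∃ (E : Type) (_ : Field E) (_ : NumberField E) (_ : IsCMField E) (_ : E →+* F₁) (Φ : CMType E)
        (ι : 𝓞 E →+* End B) (θ : E →+* Module.End ℂ (complexBetti B.X 1)), IsCMTypeRealisation Φ B ι θ) P₁)
    (hP₂ : AbelianVariety.IsProductOf (fun B : AbelianVariety ℂ =>
      ∃ (E : Type) (_ : Field E) (_ : NumberField E) (_ : IsCMField E) (_ : E →+* F₂) (Φ : CMType E)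
        (ι : 𝓞 E →+* End B) (θ : E →+* Module.End ℂ (complexBetti B.X 1)), IsCMTypeRealisation Φ B ι θ) P₂)
    (hB : AVDominatedBy B (P₁.prod P₂)) : HodgeConjectureFor B.dim B.X := by
  obtain ⟨n₁, Θ₁, hd₁⟩ := exists_avDominatedBy_cmProdAV_of_isProductOf_realisations h₃
    shimura1998_Thm3_isogenousPower_holds Shimura1998_Thm2_Cor_holds hP₁
  obtain ⟨n₂, Θ₂, hd₂⟩ := exists_avDominatedBy_cmProdAV_of_isProductOf_realisations h₃
    shimura1998_Thm3_isogenousPower_holds Shimura1998_Thm2_Cor_holds hP₂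
  exact hodgeConjectureFor_of_avDominatedBy_cmProdAV_prod_cmProdAV_of_conj_apply_eq h₃ H (hHC₁ n₁ Θ₁) (hHC₂ n₂ Θ₂)
    (hB.trans (hd₁.prod hd₂))

/-- **Odd-degree form for product trees**: `[F₁^{gal} ∩ F₂^{gal} : ℚ]` odd. [cite: MoonenZarhin1999LowDim, §3 (3.1)]
[cite: Shimura1998, §6.2 Theorem 3 and §6.1 Corollary of Theorem 2 (pp. 41–43)] -/
theorem hodgeConjectureFor_of_avDominatedBy_isProductOf_prod_isProductOf_of_odd_finrank
    (h₃ : CMAbelianVarietyRealised) (hodd : Odd (Module.finrank ℚ ↥(normalClosure ℚ F₁ ℂ ⊓ normalClosure ℚ F₂ ℂ)))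
    (hHC₁ : ∀ (n : ℕ) (Θ : Fin (n + 1) → CMType F₁),
      HodgeConjectureFor (cmProdAV F₁ h₃ n Θ).dim (cmProdAV F₁ h₃ n Θ).X)
    (hHC₂ : ∀ (n : ℕ) (Θ : Fin (n + 1) → CMType F₂),
      HodgeConjectureFor (cmProdAV F₂ h₃ n Θ).dim (cmProdAV F₂ h₃ n Θ).X)
    {P₁ P₂ B : AbelianVariety ℂ}
    (hP₁ : AbelianVariety.IsProductOf (fun B : AbelianVariety ℂ =>
      ∃ (E : Type) (_ : Field E) (_ : NumberField E) (_ : IsCMField E) (_ : E →+* F₁) (Φ : CMType E)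
        (ι : 𝓞 E →+* End B) (θ : E →+* Module.End ℂ (complexBetti B.X 1)), IsCMTypeRealisation Φ B ι θ) P₁)
    (hP₂ : AbelianVariety.IsProductOf (fun B : AbelianVariety ℂ =>
      ∃ (E : Type) (_ : Field E) (_ : NumberField E) (_ : IsCMField E) (_ : E →+* F₂) (Φ : CMType E)
        (ι : 𝓞 E →+* End B) (θ : E →+* Module.End ℂ (complexBetti B.X 1)), IsCMTypeRealisation Φ B ι θ) P₂)
    (hB : AVDominatedBy B (P₁.prod P₂)) : HodgeConjectureFor B.dim B.X :=
  hodgeConjectureFor_of_avDominatedBy_isProductOf_prod_isProductOf_of_conj_apply_eq h₃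
    (conj_apply_eq_of_odd_finrank_normalClosure_inf hodd) hHC₁ hHC₂ hP₁ hP₂ hB

end TwoFields

/-! ## §3 Two Galois sextic CM fields meeting in a totally real field, given Markman's theorem only -/

namespace CyclicSextic

/-- **Two Galois sextic CM slices with totally real intersection.**  `K₁`, `K₂` Galois sextic CM fields with complex
conjugation fixing `K₁ ∩ K₂` (inside `ℂ`) pointwise — e.g. `ℚ(ζ₇)` and `ℚ(ζ₇)⁺(√−3)`, meeting in the real cubic field;
`P₁`, `P₂` product trees of realisations of CM types of CM fields embeddable in `K₁`, resp. `K₂` (so the DEGENERATE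
curve-times-threefold pairs of both towers are allowed).  Then HC holds for every `B ≼ P₁ × P₂`, GIVEN ONLY Markman's
fourfold theorem (b30's rung `hodgeConjectureFor_cmProdAV_sextic_of_markman_closed` on both sides).
[cite: Markman2025SurveySecant, Thm. 1.2] [cite: MoonenZarhin1999LowDim, §3 (3.1)] -/
theorem hodgeConjectureFor_of_avDominatedBy_isProductOf_prod_isProductOf_two_sextics_of_markman
    (hW4 : Markman2025_weilClasses_algebraic_abelianFourfold) (K₁ K₂ : CMField) [IsGalois ℚ K₁] [IsGalois ℚ K₂]
    (h6₁ : Module.finrank ℚ K₁ = 6) (h6₂ : Module.finrank ℚ K₂ = 6)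
    (H : ∀ x : ℂ, x ∈ normalClosure ℚ (K₁ : Type) ℂ → x ∈ normalClosure ℚ (K₂ : Type) ℂ → starRingEnd ℂ x = x)
    {P₁ P₂ B : AbelianVariety ℂ}
    (hP₁ : AbelianVariety.IsProductOf (fun B : AbelianVariety ℂ =>
      ∃ (E : Type) (_ : Field E) (_ : NumberField E) (_ : IsCMField E) (_ : E →+* (K₁ : Type)) (Φ : CMType E)
        (ι : 𝓞 E →+* End B) (θ : E →+* Module.End ℂ (complexBetti B.X 1)), IsCMTypeRealisation Φ B ι θ) P₁)
    (hP₂ : AbelianVariety.IsProductOf (fun B : AbelianVariety ℂ =>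
      ∃ (E : Type) (_ : Field E) (_ : NumberField E) (_ : IsCMField E) (_ : E →+* (K₂ : Type)) (Φ : CMType E)
        (ι : 𝓞 E →+* End B) (θ : E →+* Module.End ℂ (complexBetti B.X 1)), IsCMTypeRealisation Φ B ι θ) P₂)
    (hB : AVDominatedBy B (P₁.prod P₂)) : HodgeConjectureFor B.dim B.X :=
  hodgeConjectureFor_of_avDominatedBy_isProductOf_prod_isProductOf_of_conj_apply_eq cmAbelianVarietyRealised_holds H
    (fun _ Θ => hodgeConjectureFor_cmProdAV_sextic_of_markman_closed hW4 K₁ h6₁ Θ)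
    (fun _ Θ => hodgeConjectureFor_cmProdAV_sextic_of_markman_closed hW4 K₂ h6₂ Θ) hP₁ hP₂ hB

/-- **Odd-degree form** (`[K₁ ∩ K₂ : ℚ]` odd: `1` or `3` for two distinct Galois sextic CM fields, i.e. they do NOT share
their imaginary quadratic subfield when cyclic). [cite: Markman2025SurveySecant, Thm. 1.2] [cite: MoonenZarhin1999LowDim, §3 (3.1)] -/
theorem hodgeConjectureFor_of_avDominatedBy_isProductOf_prod_isProductOf_two_sextics_of_markman_of_odd_finrank
    (hW4 : Markman2025_weilClasses_algebraic_abelianFourfold) (K₁ K₂ : CMField) [IsGalois ℚ K₁] [IsGalois ℚ K₂]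
    (h6₁ : Module.finrank ℚ K₁ = 6) (h6₂ : Module.finrank ℚ K₂ = 6)
    (hodd : Odd (Module.finrank ℚ ↥(normalClosure ℚ (K₁ : Type) ℂ ⊓ normalClosure ℚ (K₂ : Type) ℂ)))
    {P₁ P₂ B : AbelianVariety ℂ}
    (hP₁ : AbelianVariety.IsProductOf (fun B : AbelianVariety ℂ =>
      ∃ (E : Type) (_ : Field E) (_ : NumberField E) (_ : IsCMField E) (_ : E →+* (K₁ : Type)) (Φ : CMType E)
        (ι : 𝓞 E →+* End B) (θ : E →+* Module.End ℂ (complexBetti B.X 1)), IsCMTypeRealisation Φ B ι θ) P₁)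
    (hP₂ : AbelianVariety.IsProductOf (fun B : AbelianVariety ℂ =>
      ∃ (E : Type) (_ : Field E) (_ : NumberField E) (_ : IsCMField E) (_ : E →+* (K₂ : Type)) (Φ : CMType E)
        (ι : 𝓞 E →+* End B) (θ : E →+* Module.End ℂ (complexBetti B.X 1)), IsCMTypeRealisation Φ B ι θ) P₂)
    (hB : AVDominatedBy B (P₁.prod P₂)) : HodgeConjectureFor B.dim B.X :=
  hodgeConjectureFor_of_avDominatedBy_isProductOf_prod_isProductOf_two_sextics_of_markman hW4 K₁ K₂ h6₁ h6₂
    (conj_apply_eq_of_odd_finrank_normalClosure_inf hodd) hP₁ hP₂ hB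

/-- **Headline `B₁^{a+1} × E₁^{b+1} × B₂^{c+1} × E₂^{d+1}` — two Weil-type towers glued.**  `K₁`, `K₂` Galois sextic CM
fields with `[K₁ ∩ K₂ : ℚ]` odd; `B_r` a realisation of a CM type of `K_r`, `E_r` a realisation of a CM type of a CM
field `L_r ↪ K_r` (the imaginary quadratic subfields: BOTH `B_r × E_r` are the degenerate pairs whose Weil classes
Markman's theorem makes algebraic).  Then HC holds for every abelian variety dominated by
`(B₁^{a+1} × E₁^{b+1}) × (B₂^{c+1} × E₂^{d+1})`, GIVEN ONLY Markman's fourfold theorem.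
[cite: Markman2025SurveySecant, Thm. 1.2] [cite: Andre1992HodgeCM, Théorème (pp. 4–5)] [cite: MoonenZarhin1999LowDim, §3 (3.1)] -/
theorem hodgeConjectureFor_of_avDominatedBy_two_sextic_towers_of_markman_of_odd_finrank
    (hW4 : Markman2025_weilClasses_algebraic_abelianFourfold) (K₁ K₂ : CMField) [IsGalois ℚ K₁] [IsGalois ℚ K₂]
    (h6₁ : Module.finrank ℚ K₁ = 6) (h6₂ : Module.finrank ℚ K₂ = 6)
    (hodd : Odd (Module.finrank ℚ ↥(normalClosure ℚ (K₁ : Type) ℂ ⊓ normalClosure ℚ (K₂ : Type) ℂ)))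
    {Ψ₁ : CMType K₁} {B₁ : AbelianVariety ℂ} {ιB₁ : 𝓞 K₁ →+* End B₁}
    {θB₁ : (K₁ : Type) →+* Module.End ℂ (complexBetti B₁.X 1)} (hB₁ : IsCMTypeRealisation Ψ₁ B₁ ιB₁ θB₁)
    {L₁ : Type} [Field L₁] [NumberField L₁] [IsCMField L₁] (k₁ : L₁ →+* (K₁ : Type)) {Φ₁ : CMType L₁}
    {E₁ : AbelianVariety ℂ} {ιE₁ : 𝓞 L₁ →+* End E₁} {θE₁ : L₁ →+* Module.End ℂ (complexBetti E₁.X 1)}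
    (hE₁ : IsCMTypeRealisation Φ₁ E₁ ιE₁ θE₁)
    {Ψ₂ : CMType K₂} {B₂ : AbelianVariety ℂ} {ιB₂ : 𝓞 K₂ →+* End B₂}
    {θB₂ : (K₂ : Type) →+* Module.End ℂ (complexBetti B₂.X 1)} (hB₂ : IsCMTypeRealisation Ψ₂ B₂ ιB₂ θB₂)
    {L₂ : Type} [Field L₂] [NumberField L₂] [IsCMField L₂] (k₂ : L₂ →+* (K₂ : Type)) {Φ₂ : CMType L₂}
    {E₂ : AbelianVariety ℂ} {ιE₂ : 𝓞 L₂ →+* End E₂} {θE₂ : L₂ →+* Module.End ℂ (complexBetti E₂.X 1)}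
    (hE₂ : IsCMTypeRealisation Φ₂ E₂ ιE₂ θE₂) (a b c d : ℕ) {A : AbelianVariety ℂ}
    (hA : AVDominatedBy A (((B₁.powSucc a).prod (E₁.powSucc b)).prod ((B₂.powSucc c).prod (E₂.powSucc d)))) :
    HodgeConjectureFor A.dim A.X :=
  hodgeConjectureFor_of_avDominatedBy_isProductOf_prod_isProductOf_two_sextics_of_markman_of_odd_finrank hW4 K₁ K₂
    h6₁ h6₂ hodd
    (isProductOf_powSucc_prod_powSucc (Q := fun B : AbelianVariety ℂ =>
      ∃ (E : Type) (_ : Field E) (_ : NumberField E) (_ : IsCMField E) (_ : E →+* (K₁ : Type)) (Φ : CMType E)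
        (ι : 𝓞 E →+* End B) (θ : E →+* Module.End ℂ (complexBetti B.X 1)), IsCMTypeRealisation Φ B ι θ)
      ⟨K₁, inferInstance, inferInstance, inferInstance, RingHom.id _, Ψ₁, ιB₁, θB₁, hB₁⟩
      ⟨L₁, inferInstance, inferInstance, inferInstance, k₁, Φ₁, ιE₁, θE₁, hE₁⟩ a b)
    (isProductOf_powSucc_prod_powSucc (Q := fun B : AbelianVariety ℂ =>
      ∃ (E : Type) (_ : Field E) (_ : NumberField E) (_ : IsCMField E) (_ : E →+* (K₂ : Type)) (Φ : CMType E)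
        (ι : 𝓞 E →+* End B) (θ : E →+* Module.End ℂ (complexBetti B.X 1)), IsCMTypeRealisation Φ B ι θ)
      ⟨K₂, inferInstance, inferInstance, inferInstance, RingHom.id _, Ψ₂, ιB₂, θB₂, hB₂⟩
      ⟨L₂, inferInstance, inferInstance, inferInstance, k₂, Φ₂, ιE₂, θE₂, hE₂⟩ c d) hA

end CyclicSextic

end Summit.HodgeConjecture.CorCM

end
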